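import Summits.Ventures.PercRepro.GenQSevenFiveTypeTwo
import Summits.Ventures.PercRepro.GenQEightSixTypeTwo
import Summits.Ventures.PercRepro.GenQNineSevenTypeTwo
import Summits.Ventures.PercRepro.GenQTenEightTypeTwo
import Summits.Ventures.PercRepro.GenQElevenNineTypeTwo
import Summits.Ventures.PercRepro.GenQTwelveTenTypeTwo
import Summits.Ventures.PercRepro.GenQThirteenElevenTypeTwo

/-!
# PercRepro — THE `t = 2` WINDOW OF EVERY DIAGONAL ROW `q = 5 … 11`, AS ONE STATEMENT (night-4, gen 3; sheet §50–§51)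

`TypeTwoWindowCoreFree q` is the type-`2` clause of `OpenLayersCoreFree q` (the balance `0 ≤ Jq M G q 2` on the
coloop-free rank-`q` flats of rank-`(q + 2)` Core matroids with `(g − q)(g − q + 3) < 12(q − 1)`), and
`ResidueCoreFree q` is `OpenLayersCoreFree q` without that clause.  For every `5 ≤ q ≤ 11` the window is the kernel
theorem of the level (`jq_two_nonneg_of_core_{five, …, eleven}`), so `OpenLayersCoreFree q ⇐ ResidueCoreFree q` and
every row `(q + 2, q)` of the range reduces to the trace sums of the lower levels and the residues without `t = 2`
(`rls_succ_succ_of_residues`).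
-/

namespace PercRepro.GenQ

open Finset ThmH PerFlat SixFour ThmN NightThree

/-- **The type-`2` window of level `q`** (the second clause of `OpenLayersCoreFree q`). -/
def TypeTwoWindowCoreFree (q : ℕ) : Prop :=
  ∀ {β : Type} [DecidableEq β] (M : Matroid β) [M.Finite] (G : Finset β), Core M (q + 2) → G ∈ flatsQ M q →
    mTr M G = 0 → (G.card - q) * (G.card - q + 3) < 12 * (q - 1) → 0 ≤ Jq M G q 2

/-- **The residue of level `q`**: `OpenLayersCoreFree q` without its type-`2` clause. -/
def ResidueCoreFree (q : ℕ) : Prop :=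
  ∀ {β : Type} [DecidableEq β] (M : Matroid β) [M.Finite] (G : Finset β), Core M (q + 2) → G ∈ flatsQ M q →
    TwoHyp M G q → mTr M G = 0 →
      (6 ≤ q → q + 2 ≤ G.card → (G.card - q) * (q + 3) + 1 < q * q → 0 ≤ Jq M G q 1) ∧
      (∀ t, 3 ≤ t → t + 1 ≤ q → 0 ≤ Jq M G q t)

/-- **The type-`2` window is a theorem at every level `5 ≤ q ≤ 11`.** -/
theorem typeTwoWindowCoreFree_of_le_eleven {q : ℕ} (hq : 5 ≤ q) (hq' : q ≤ 11) : TypeTwoWindowCoreFree q := by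
  intro β _ M _ G hc hG hfree hwin
  interval_cases q
  · apply jq_two_nonneg_of_core_five hc hG
    by_contra hg
    push Not at hg
    have h1 : 6 ≤ G.card - 5 := by omega
    have h2 : 9 ≤ G.card - 5 + 3 := by omega
    have := Nat.mul_le_mul h1 h2
    omega
  · apply jq_two_nonneg_of_core_six hc hG
    by_contra hg
    push Not at hg
    have h1 : 7 ≤ G.card - 6 := by omega
    have h2 : 10 ≤ G.card - 6 + 3 := by omega
    have := Nat.mul_le_mul h1 h2
    omega
  · apply jq_two_nonneg_of_core_seven hc hG hfree
    by_contra hg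
    push Not at hg
    have h1 : 8 ≤ G.card - 7 := by omega
    have h2 : 11 ≤ G.card - 7 + 3 := by omega
    have := Nat.mul_le_mul h1 h2
    omega
  · apply jq_two_nonneg_of_core_eight hc hG hfree
    by_contra hg
    push Not at hg
    have h1 : 8 ≤ G.card - 8 := by omega
    have h2 : 11 ≤ G.card - 8 + 3 := by omega
    have := Nat.mul_le_mul h1 h2
    omega
  · apply jq_two_nonneg_of_core_nine hc hG hfree
    by_contra hg
    push Not at hg
    have h1 : 9 ≤ G.card - 9 := by omega
    have h2 : 12 ≤ G.card - 9 + 3 := by omega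
    have := Nat.mul_le_mul h1 h2
    omega
  · apply jq_two_nonneg_of_core_ten hc hG hfree
    by_contra hg
    push Not at hg
    have h1 : 9 ≤ G.card - 10 := by omega
    have h2 : 12 ≤ G.card - 10 + 3 := by omega
    have := Nat.mul_le_mul h1 h2
    omega
  · apply jq_two_nonneg_of_core_eleven hc hG hfree
    by_contra hg
    push Not at hg
    have h1 : 10 ≤ G.card - 11 := by omega
    have h2 : 13 ≤ G.card - 11 + 3 := by omega
    have := Nat.mul_le_mul h1 h2
    omega

/-- **`OpenLayersCoreFree q` from its residue** for `5 ≤ q ≤ 11`: the type-`2` clause is the kernel window. -/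
theorem openLayersCoreFree_of_residue {q : ℕ} (hq : 5 ≤ q) (hq' : q ≤ 11) (h : ResidueCoreFree q) :
    OpenLayersCoreFree q := by
  intro β _ M _ G hc hG hF hfree
  obtain ⟨h1, h3⟩ := h M G hc hG hF hfree
  exact ⟨h1, fun hwin => typeTwoWindowCoreFree_of_le_eleven hq hq' M G hc hG hfree hwin, h3⟩

/-- **Every row `(q + 2, q)`, `5 ≤ q ≤ 11`, on every finite matroid from the trace sums of the levels `4 … q − 1`
and the residues without `t = 2` of the levels `5 … q`.** -/
theorem rls_succ_succ_of_residues {α : Type} [DecidableEq α] (q : ℕ) (hq : 5 ≤ q) (hq' : q ≤ 11)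
    (htr : ∀ q', 4 ≤ q' → q' + 1 ≤ q → TraceSumsCore q') (hres : ∀ q', 5 ≤ q' → q' ≤ q → ResidueCoreFree q') :
    ∀ (M : Matroid α) [M.Finite], RLS M (q + 2) q :=
  rls_succ_succ_of_free q (by omega) htr
    (fun q' h5 hq'' => openLayersCoreFree_of_residue h5 (by omega) (hres q' h5 hq''))

end PercRepro.GenQ
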